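import Literature.NumberTheory.Automorphic.UnitaryGroupArchimedean
import Literature.Analysis.Calculus.CayleyTransform
import Mathlib.Analysis.Matrix.Normed
import Mathlib.Analysis.Normed.Algebra.MatrixExponential
import HarnessLib

/-!
# The `J`-skew-hermitian matrices `𝔲 = {X ∈ M_N(E ⊗ ℝ) | (σX)ᵀ J′ + J′ X = 0}` of `U(J)(E ⊗ ℝ)`: the Cayley transform
# exchanges `𝔲 ∩ {1 + X invertible}` with `U(J)(E ⊗ ℝ) ∩ {1 + g invertible}`, and `exp 𝔲 ⊆ U(J)(E ⊗ ℝ)` — for EVERY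
# form `J`, degenerate or not
(Weyl, *The Classical Groups* (1939), Ch. II §10; Knapp, *Lie Groups Beyond an Introduction* (2002), Introduction §2, I §1.)

Topic `NumberTheory/Automorphic`; namespace `Literature.NumberTheory.Automorphic.UnitaryGroup`.  Definitions with bodies
(`archStar`, `archStarL`, `archStarUnit`, `archSkew`) and proved theorems: no named fact, no instance, no notation, no `sorry`.
Cell `hodgecm-mathlib`, F0∕P3 road «DM∞» (archimedean Dixmier–Malliavin, weak form, for `U(H)(L⁺ ⊗ ℝ)`; census
`F0/P3/p03/CENSUS-DMinf.F0P3p03g8.md`), brick B5a, algebraic part (generic Cayley transform: ★ `Analysis/Calculus/CayleyTransform`;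
the chart as a map of subtypes: companion `UnitaryGroupArchCayleyChart`).

SETTING (★ `UnitaryGroupArchimedean`): number fields `F ⊆ E` (only `Field` is used until §3b), `c : E ≃ₐ[F] E`, `N : ℕ`,
`J ∈ M_N(E)`; `M = M_N(E ⊗_ℚ ℝ) = Matrix (Fin N) (Fin N) (mixedSpace E)`, `σ = c ⊗ 1 = conjMixed F E c`, `J′ = archFormOf E N J`,
`U(J)(E ⊗ ℝ) = arch F E c N J = {g ∈ GL_N(E ⊗ ℝ) | (σg)ᵀ J′ g = J′}`.

CONTENT.
* §3 the `σ`-transpose **`archStar X = (σX)ᵀ`** (anti-multiplicative, additive, `ℝ`-linear, continuous — `archStarL`; maps units to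
  units — `archStarUnit`, `archStar_inverse`; commutes with the Cayley transform — `archStar_cayley`); the real subspace
  **`archSkew F E c N J = 𝔲`**, `mem_archSkew_iff`, `isClosed_archSkew`; `mem_arch_iff_archStar`; THE KEY EQUIVALENCE
  **`archStar_cayley_mul_mul_cayley_eq_iff`**: for `1 + X` invertible, `(σ c(X))ᵀ J′ c(X) = J′ ↔ X ∈ 𝔲` — one line of algebra,
  `(1+X*) J′ (1+X) − (1−X*) J′ (1−X) = 2 (X*J′ + J′X)`, no hypothesis on `J′`; hence **`cayley_mem_arch`** (`c(X) ∈ U(J)` for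
  `X ∈ 𝔲` with `1 ± X` invertible) and **`cayley_coe_mem_archSkew`** (`c(g) ∈ 𝔲` for `g ∈ U(J)` with `1 + g` invertible),
  `isUnit_one_sub_cayley_coe`.
* §3b (here `E` is a number field: the scoped `L∞`-operator normed algebra `Matrix.Norms.Operator` on `M`, as for ★ `IsArchSmooth`)
  **`expGL_mem_arch`**: `exp X ∈ U(J)(E ⊗ ℝ)` for `X ∈ 𝔲` — `X*J′ = J′(−X)` gives `exp(X*) J′ = J′ exp(−X)` (Mathlib
  `SemiconjBy.exp_right`), `(σ exp X)ᵀ = exp X*` (★ `map_conjMixed_exp`, `Matrix.exp_transpose`), `exp(−X) exp X = 1`; NO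
  invertibility of `J′` is used (contrast ★ `archGroup.expGL_smul_mem`, standard forms, which conjugates by `J₀ = J₀⁻¹`);
  `expGL_smul_mem_arch` (the one-parameter subgroups `t ↦ exp(tX)` of the road's coordinates of the second kind).

HONEST SCOPE.  Elementary matrix algebra over the tree's `arch`; no Lie-theoretic statement (that `𝔲` IS the Lie algebra, i.e.
that every one-parameter subgroup of `U(J)(E ⊗ ℝ)` has its generator in `𝔲`, is not claimed here).  HC_CM is proved only modulo
the printed citations until rung 0 closes; this file discharges no printed statement (banked currency for the road's B6∕B7).

## References
* H. Weyl, *The Classical Groups, their Invariants and Representations*, Princeton (1939), Ch. II §10. [Weyl1939]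
* A. W. Knapp, *Lie Groups Beyond an Introduction*, 2nd ed., Birkhäuser (2002), Introduction §2, I §1. [Knapp2002]
* A. Borel, H. Jacquet, *Automorphic forms and automorphic representations*, PSPM 33.1 (1979), §4.1. [BorelJacquet1979]
-/

set_option autoImplicit false

noncomputable section

open NumberField NumberField.mixedEmbedding Set Filter Topology Literature.Analysis.Calculus
-- `Classical`: the place subtypes indexing `mixedSpace E` are `Fintype` classically (`NormedCommRing (mixedSpace E)`);
-- `Matrix.Norms.Operator`: the scoped `L∞`-operator normed algebra structure on `M_N(E ⊗ ℝ)` (as for ★ `IsArchSmooth`).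
open scoped Classical Matrix Matrix.Norms.Operator MatrixGroups

namespace Literature.NumberTheory.Automorphic

namespace UnitaryGroup

/-! ## §3 The `σ`-transpose, the `J`-skew-hermitian matrices `𝔲`, and the key equivalence -/

section ArchAlgebra

variable (F E : Type) [Field F] [Field E] [Algebra F E] (c : E ≃ₐ[F] E) (N : ℕ) (J : Matrix (Fin N) (Fin N) E)

/-- The `σ`-transpose `X ↦ (σ X)ᵀ` on `M_N(E ⊗ ℝ)`, `σ = c ⊗ 1 = conjMixed F E c` (the «adjoint» with respect to which
`U(J)(E ⊗ ℝ) = {g | archStar g * J′ * g = J′}`). [cite: Knapp2002, I §1] -/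
def archStar (X : Matrix (Fin N) (Fin N) (mixedSpace E)) : Matrix (Fin N) (Fin N) (mixedSpace E) :=
  (X.map (conjMixed F E c))ᵀ

variable {F E c N}

/-- Unfolding of `archStar`. [cite: Knapp2002, I §1] -/
theorem archStar_apply (X : Matrix (Fin N) (Fin N) (mixedSpace E)) : archStar F E c N X = (X.map (conjMixed F E c))ᵀ := rfl

/-- `archStar` is anti-multiplicative. [cite: Knapp2002, I §1] -/
theorem archStar_mul (X Y : Matrix (Fin N) (Fin N) (mixedSpace E)) :
    archStar F E c N (X * Y) = archStar F E c N Y * archStar F E c N X := by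
  rw [archStar_apply, archStar_apply, archStar_apply, Matrix.map_mul, Matrix.transpose_mul]

/-- `archStar 1 = 1`. [cite: Knapp2002, I §1] -/
@[simp] theorem archStar_one : archStar F E c N (1 : Matrix (Fin N) (Fin N) (mixedSpace E)) = 1 := by
  rw [archStar_apply, Matrix.map_one _ (map_zero _) (map_one _), Matrix.transpose_one]

/-- `archStar 0 = 0`. [cite: Knapp2002, I §1] -/
@[simp] theorem archStar_zero : archStar F E c N (0 : Matrix (Fin N) (Fin N) (mixedSpace E)) = 0 := by
  rw [archStar_apply, Matrix.map_zero _ (map_zero _), Matrix.transpose_zero]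

/-- `archStar` is additive. [cite: Knapp2002, I §1] -/
theorem archStar_add (X Y : Matrix (Fin N) (Fin N) (mixedSpace E)) :
    archStar F E c N (X + Y) = archStar F E c N X + archStar F E c N Y := by
  rw [archStar_apply, archStar_apply, archStar_apply, Matrix.map_add _ (map_add _), Matrix.transpose_add]

/-- `archStar` commutes with negation. [cite: Knapp2002, I §1] -/
theorem archStar_neg (X : Matrix (Fin N) (Fin N) (mixedSpace E)) : archStar F E c N (-X) = -archStar F E c N X := by
  rw [archStar_apply, archStar_apply, Matrix.map_neg _ (map_neg _), Matrix.transpose_neg]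

/-- `archStar` is subtractive. [cite: Knapp2002, I §1] -/
theorem archStar_sub (X Y : Matrix (Fin N) (Fin N) (mixedSpace E)) :
    archStar F E c N (X - Y) = archStar F E c N X - archStar F E c N Y := by
  rw [sub_eq_add_neg, archStar_add, archStar_neg, ← sub_eq_add_neg]

/-- `archStar` is `ℝ`-linear (`conjMixed` is, ★ `conjMixed_real_smul`). [cite: Knapp2002, I §1] -/
theorem archStar_smul (t : ℝ) (X : Matrix (Fin N) (Fin N) (mixedSpace E)) :
    archStar F E c N (t • X) = t • archStar F E c N X := by
  rw [archStar_apply, archStar_apply, Matrix.map_smul _ _ (conjMixed_real_smul F E c t), Matrix.transpose_smul]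

/-- `archStar` is continuous. [cite: Knapp2002, I §1] -/
theorem continuous_archStar : Continuous (archStar F E c N) :=
  (continuous_id.matrix_map (continuous_conjMixed F E c)).matrix_transpose

variable (F E c N) in
/-- `archStar` as a continuous `ℝ`-linear map. [cite: Knapp2002, I §1] -/
def archStarL : Matrix (Fin N) (Fin N) (mixedSpace E) →L[ℝ] Matrix (Fin N) (Fin N) (mixedSpace E) where
  toFun := archStar F E c N
  map_add' := archStar_add
  map_smul' := archStar_smul
  cont := continuous_archStar

/-- `archStarL X = archStar X`. [cite: Knapp2002, I §1] -/
@[simp] theorem archStarL_apply (X : Matrix (Fin N) (Fin N) (mixedSpace E)) : archStarL F E c N X = archStar F E c N X := rfl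

/-- `archStar` maps units to units: `archStar ↑u` is a unit with inverse `archStar ↑u⁻¹`. [cite: Knapp2002, I §1] -/
theorem archStar_units_inv_mul (u : (Matrix (Fin N) (Fin N) (mixedSpace E))ˣ) :
    archStar F E c N ((u⁻¹ : (Matrix (Fin N) (Fin N) (mixedSpace E))ˣ) : Matrix (Fin N) (Fin N) (mixedSpace E)) *
      archStar F E c N (u : Matrix (Fin N) (Fin N) (mixedSpace E)) = 1 := by
  rw [← archStar_mul, Units.mul_inv, archStar_one]

/-- Companion: `archStar ↑u * archStar ↑u⁻¹ = 1`. [cite: Knapp2002, I §1] -/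
theorem archStar_units_mul_inv (u : (Matrix (Fin N) (Fin N) (mixedSpace E))ˣ) :
    archStar F E c N (u : Matrix (Fin N) (Fin N) (mixedSpace E)) *
      archStar F E c N ((u⁻¹ : (Matrix (Fin N) (Fin N) (mixedSpace E))ˣ) : Matrix (Fin N) (Fin N) (mixedSpace E)) = 1 := by
  rw [← archStar_mul, Units.inv_mul, archStar_one]

variable (F E c N) in
/-- The unit `archStar ↑u` (inverse `archStar ↑u⁻¹`). [cite: Knapp2002, I §1] -/
def archStarUnit (u : (Matrix (Fin N) (Fin N) (mixedSpace E))ˣ) : (Matrix (Fin N) (Fin N) (mixedSpace E))ˣ :=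
  ⟨archStar F E c N (u : Matrix (Fin N) (Fin N) (mixedSpace E)),
    archStar F E c N ((u⁻¹ : (Matrix (Fin N) (Fin N) (mixedSpace E))ˣ) : Matrix (Fin N) (Fin N) (mixedSpace E)),
    archStar_units_mul_inv u, archStar_units_inv_mul u⟩

/-- `↑(archStarUnit u) = archStar ↑u`. [cite: Knapp2002, I §1] -/
@[simp] theorem coe_archStarUnit (u : (Matrix (Fin N) (Fin N) (mixedSpace E))ˣ) :
    (archStarUnit F E c N u : Matrix (Fin N) (Fin N) (mixedSpace E)) = archStar F E c N (u : Matrix (Fin N) (Fin N) (mixedSpace E)) :=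
  rfl

/-- `archStar` preserves units. [cite: Knapp2002, I §1] -/
theorem isUnit_archStar {X : Matrix (Fin N) (Fin N) (mixedSpace E)} (h : IsUnit X) : IsUnit (archStar F E c N X) := by
  obtain ⟨u, rfl⟩ := h
  exact ⟨archStarUnit F E c N u, rfl⟩

/-- `archStar` commutes with `Ring.inverse` at units. [cite: Knapp2002, I §1] -/
theorem archStar_inverse {X : Matrix (Fin N) (Fin N) (mixedSpace E)} (h : IsUnit X) :
    archStar F E c N (Ring.inverse X) = Ring.inverse (archStar F E c N X) := by
  obtain ⟨u, rfl⟩ := h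
  rw [Ring.inverse_unit, ← coe_archStarUnit (u := u), Ring.inverse_unit]
  rfl

/-- `archStar (1 + X) = 1 + archStar X`. [cite: Knapp2002, I §1] -/
theorem archStar_one_add (X : Matrix (Fin N) (Fin N) (mixedSpace E)) : archStar F E c N (1 + X) = 1 + archStar F E c N X := by
  rw [archStar_add, archStar_one]

/-- `archStar (1 − X) = 1 − archStar X`. [cite: Knapp2002, I §1] -/
theorem archStar_one_sub (X : Matrix (Fin N) (Fin N) (mixedSpace E)) : archStar F E c N (1 - X) = 1 - archStar F E c N X := by
  rw [archStar_sub, archStar_one]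

/-- **`archStar` commutes with the Cayley transform** (for `1 + X` a unit): `(σ c(X))ᵀ = c((σX)ᵀ)`.
[cite: Weyl1939, Ch. II §10] -/
theorem archStar_cayley {X : Matrix (Fin N) (Fin N) (mixedSpace E)} (h : IsUnit (1 + X)) :
    archStar F E c N (cayley X) = cayley (archStar F E c N X) := by
  have h' : IsUnit (1 + archStar F E c N X) := by rw [← archStar_one_add]; exact isUnit_archStar h
  rw [cayley_def, archStar_mul, archStar_inverse h, archStar_one_add, archStar_one_sub, cayley_eq_inverse_mul h']

variable (F E c N) in
/-- **The `J`-skew-hermitian matrices `𝔲 = {X ∈ M_N(E ⊗ ℝ) | (σX)ᵀ J′ + J′ X = 0}`** — the Lie algebra of `U(J)(E ⊗ ℝ)`,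
as a real subspace (`J′ = archFormOf E N J`; for the standard forms this is the carrier of ★ `archLie`).
[cite: Knapp2002, I §1] -/
def archSkew : Submodule ℝ (Matrix (Fin N) (Fin N) (mixedSpace E)) where
  carrier := {X | archStar F E c N X * archFormOf E N J + archFormOf E N J * X = 0}
  zero_mem' := by simp
  add_mem' {X Y} hX hY := by
    simp only [Set.mem_setOf_eq] at hX hY ⊢
    rw [archStar_add, add_mul, mul_add, add_add_add_comm, hX, hY, add_zero]
  smul_mem' t X hX := by
    simp only [Set.mem_setOf_eq] at hX ⊢
    rw [archStar_smul, smul_mul_assoc, mul_smul_comm, ← smul_add, hX, smul_zero]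

/-- Membership in `𝔲`. [cite: Knapp2002, I §1] -/
theorem mem_archSkew_iff (X : Matrix (Fin N) (Fin N) (mixedSpace E)) :
    X ∈ archSkew F E c N J ↔ archStar F E c N X * archFormOf E N J + archFormOf E N J * X = 0 :=
  Iff.rfl

/-- `𝔲` is closed. [cite: Knapp2002, I §1] -/
theorem isClosed_archSkew : IsClosed (archSkew F E c N J : Set (Matrix (Fin N) (Fin N) (mixedSpace E))) :=
  isClosed_eq ((continuous_archStar.mul continuous_const).add (continuous_const.mul continuous_id)) continuous_const

/-- Membership in `U(J)(E ⊗ ℝ)` in the `archStar` spelling. [cite: BorelJacquet1979, §4.1] -/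
theorem mem_arch_iff_archStar (g : GL (Fin N) (mixedSpace E)) :
    g ∈ arch F E c N J ↔
      archStar F E c N (g : Matrix (Fin N) (Fin N) (mixedSpace E)) * archFormOf E N J * (g : Matrix (Fin N) (Fin N) (mixedSpace E)) =
        archFormOf E N J :=
  mem_arch_iff F E c N J g

/-- **THE KEY EQUIVALENCE.**  For `1 + X` invertible, `(σ c(X))ᵀ · J′ · c(X) = J′ ↔ (σX)ᵀ J′ + J′ X = 0` — one line of algebra:
`(1 − X*) J′ (1 − X) = (1 + X*) J′ (1 + X) ⟺ 2 (X*J′ + J′X) = 0`.  No hypothesis on `J′`. [cite: Weyl1939, Ch. II §10] -/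
theorem archStar_cayley_mul_mul_cayley_eq_iff {X : Matrix (Fin N) (Fin N) (mixedSpace E)} (h : IsUnit (1 + X)) :
    archStar F E c N (cayley X) * archFormOf E N J * cayley X = archFormOf E N J ↔ X ∈ archSkew F E c N J := by
  have h' : IsUnit (1 + archStar F E c N X) := by rw [← archStar_one_add]; exact isUnit_archStar h
  obtain ⟨u, hu⟩ := id h
  obtain ⟨v, hv⟩ := id h'
  have hiu : Ring.inverse (1 + X) = ((u⁻¹ : (Matrix (Fin N) (Fin N) (mixedSpace E))ˣ) : Matrix (Fin N) (Fin N) (mixedSpace E)) := by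
    rw [← hu, Ring.inverse_unit]
  have hiv : Ring.inverse (1 + archStar F E c N X) =
      ((v⁻¹ : (Matrix (Fin N) (Fin N) (mixedSpace E))ˣ) : Matrix (Fin N) (Fin N) (mixedSpace E)) := by
    rw [← hv, Ring.inverse_unit]
  rw [mem_archSkew_iff]
  -- `c(X)* J′ c(X) = (1+X*)⁻¹ ((1 − X*) J′ (1 − X)) (1+X)⁻¹`
  have e1 : archStar F E c N (cayley X) * archFormOf E N J * cayley X =
      ((v⁻¹ : (Matrix (Fin N) (Fin N) (mixedSpace E))ˣ) : Matrix (Fin N) (Fin N) (mixedSpace E)) *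
        ((1 - archStar F E c N X) * archFormOf E N J * (1 - X)) *
        ((u⁻¹ : (Matrix (Fin N) (Fin N) (mixedSpace E))ˣ) : Matrix (Fin N) (Fin N) (mixedSpace E)) := by
    rw [archStar_cayley h, cayley_eq_inverse_mul h', cayley_def, hiu, hiv]
    simp only [mul_assoc]
  -- `(1 + X*) J′ (1 + X) − (1 − X*) J′ (1 − X) = 2 (X* J′ + J′ X)`
  have e4 : (v : Matrix (Fin N) (Fin N) (mixedSpace E)) * archFormOf E N J * (u : Matrix (Fin N) (Fin N) (mixedSpace E)) -
      (1 - archStar F E c N X) * archFormOf E N J * (1 - X) =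
      2 * (archStar F E c N X * archFormOf E N J + archFormOf E N J * X) := by
    rw [hu, hv]; noncomm_ring
  rw [e1]
  constructor
  · intro e
    have e2 : (1 - archStar F E c N X) * archFormOf E N J * (1 - X) =
        (v : Matrix (Fin N) (Fin N) (mixedSpace E)) * archFormOf E N J * (u : Matrix (Fin N) (Fin N) (mixedSpace E)) := by
      conv_rhs => rw [← e]
      simp only [mul_assoc, Units.mul_inv_cancel_left, Units.inv_mul, mul_one]
    rw [← two_mul_eq_zero_iff, ← e4, e2, sub_self]
  · intro e
    rw [e, mul_zero, sub_eq_zero] at e4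
    rw [← e4]
    simp only [mul_assoc, Units.inv_mul_cancel_left, Units.mul_inv, mul_one]

/-- **The Cayley transform of a `J`-skew-hermitian `X` with `1 ± X` invertible lies in `U(J)(E ⊗ ℝ)`.**
[cite: Weyl1939, Ch. II §10] -/
theorem cayley_mem_arch {X : Matrix (Fin N) (Fin N) (mixedSpace E)} (hX : X ∈ archSkew F E c N J) (h : IsUnit (1 + X))
    (h' : IsUnit (1 - X)) : (isUnit_cayley h h').unit ∈ arch F E c N J := by
  rw [mem_arch_iff_archStar, IsUnit.unit_spec]
  exact (archStar_cayley_mul_mul_cayley_eq_iff J h).2 hX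

/-- **Conversely, the Cayley transform of `g ∈ U(J)(E ⊗ ℝ)` with `1 + g` invertible is `J`-skew-hermitian.**
[cite: Weyl1939, Ch. II §10] -/
theorem cayley_coe_mem_archSkew {g : GL (Fin N) (mixedSpace E)} (hg : g ∈ arch F E c N J)
    (h : IsUnit (1 + (g : Matrix (Fin N) (Fin N) (mixedSpace E)))) :
    cayley (g : Matrix (Fin N) (Fin N) (mixedSpace E)) ∈ archSkew F E c N J := by
  have h1 : IsUnit (1 + cayley (g : Matrix (Fin N) (Fin N) (mixedSpace E))) := isUnit_one_add_cayley h
  rw [← archStar_cayley_mul_mul_cayley_eq_iff J h1, cayley_cayley h]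
  exact (mem_arch_iff_archStar J g).1 hg

/-- For `g` invertible with `1 + g` invertible, `1 ± c(g)` are invertible. [cite: Weyl1939, Ch. II §10] -/
theorem isUnit_one_sub_cayley_coe (g : GL (Fin N) (mixedSpace E)) (h : IsUnit (1 + (g : Matrix (Fin N) (Fin N) (mixedSpace E)))) :
    IsUnit (1 - cayley (g : Matrix (Fin N) (Fin N) (mixedSpace E))) :=
  (isUnit_one_sub_cayley_iff h).2 (Units.isUnit g)

end ArchAlgebra

/-! ## §3b Exponentials and the chart (the normed structure of `M_N(E ⊗ ℝ)` enters: `E` a number field) -/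

section ArchAnalysis

variable (F E : Type) [Field F] [Field E] [NumberField E] [Algebra F E] (c : E ≃ₐ[F] E) (N : ℕ) (J : Matrix (Fin N) (Fin N) E)

variable {F E c N}

/-- **`exp X ∈ U(J)(E ⊗ ℝ)` for `X ∈ 𝔲`**: from `X*J′ = J′(−X)` one gets `exp(X*) J′ = J′ exp(−X)` (Mathlib
`SemiconjBy.exp_right`, the exponential series), `(σ exp X)ᵀ = exp X*` (★ `map_conjMixed_exp`, `Matrix.exp_transpose`), and
`exp(−X) exp X = 1`.  No invertibility of `J′` is used. [cite: Knapp2002, Introduction §2, I §1] -/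
theorem expGL_mem_arch {X : Matrix (Fin N) (Fin N) (mixedSpace E)} (hX : X ∈ archSkew F E c N J) : expGL X ∈ arch F E c N J := by
  rw [mem_arch_iff_archStar, coe_expGL]
  have hsemi : SemiconjBy (archFormOf E N J) (-X) (archStar F E c N X) := by
    rw [mem_archSkew_iff] at hX
    rw [SemiconjBy, mul_neg, eq_comm, ← sub_eq_zero, sub_neg_eq_add]
    exact hX
  have h1 : archStar F E c N (NormedSpace.exp X) = NormedSpace.exp (archStar F E c N X) := by
    rw [archStar_apply, archStar_apply, map_conjMixed_exp, ← Matrix.exp_transpose]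
  have h2 : archFormOf E N J * NormedSpace.exp (-X) = NormedSpace.exp (archStar F E c N X) * archFormOf E N J :=
    hsemi.exp_right
  rw [h1, ← h2, mul_assoc, ← coe_expGL, ← coe_expGL, ← Units.val_mul, expGL_neg, inv_mul_cancel, Units.val_one, mul_one]

/-- `exp (t X) ∈ U(J)(E ⊗ ℝ)` for `X ∈ 𝔲` and real `t` (the one-parameter subgroups of the road's coordinates of the second
kind). [cite: Knapp2002, I §1] -/
theorem expGL_smul_mem_arch {X : Matrix (Fin N) (Fin N) (mixedSpace E)} (hX : X ∈ archSkew F E c N J) (t : ℝ) :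
    expGL (t • X) ∈ arch F E c N J :=
  expGL_mem_arch J ((archSkew F E c N J).smul_mem t hX)

end ArchAnalysis

end UnitaryGroup

end Literature.NumberTheory.Automorphic
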